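/-
Copyright (c) 2026 the pub-hodgecm-mathlib formalisation cell (harness21).  Prover seat hodgecm-mathlib-K2Liu-p05 (g4), 2026-09-04
(Track B «K2-LIT», crux hLiu418 = stmt-HodgeConjecture-24832, LEAD F0P6-plan (g13) RULING M-157m (1) organ (SD-1-ind), file (V-4b):
the archimedean Whittaker coefficient of a `K_w`-finite FLAT weight-`k` section on `U(2,2)` is a FINITE combination, with constant coefficients, of
real `h`-line derivatives of Shimura's `ξ(1, ·; s + 1 − k∕2 + m, s + 1 + k∕2 + n)` at `h` along hermitian directions).
-/
import Summits.HodgeConjecture.HodgeConjecture.Theorems.K2LiuKFiniteSectionXiIntegrandMoments      -- ★ (IV-b) (this seat)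
import Summits.HodgeConjecture.HodgeConjecture.Theorems.K2LiuXiTwoMomentsAsHDerivatives           -- ★ (V-1)
import Summits.HodgeConjecture.HodgeConjecture.Theorems.K2LiuPolynomialsAsHermitianTracePowers    -- (V-4a)
import HarnessLib

/-!
# (SD-1-ind, V-4b) `W_h(s; f) = Σ_j κ_j · (d∕dt)^{e_j} ξ(1, h + tΘ_j; s + 1 − k∕2 + m_j, s + 1 + k∕2 + n_j)|_{t=0}` (real `t`, hermitian `Θ_j`)

Track B ∕ K2-LIT, hLiu418 = stmt-HodgeConjecture-24832; LEAD F0P6-plan (g13) RULING M-157m (1).  Namespace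
`Summit.HodgeConjecture.HodgeConjecture.Cruxes.HLiu418.K2LiuKFiniteSectionWhittakerAsHLineDerivatives`.  THEOREMS ONLY; `--supports stmt-HodgeConjecture-24832 --as helper`.

INPUT (a FLAT `K_w`-finite family).  `f : ℂ → (M₄(ℂ) → ℂ)` with `f s` a Siegel section of `I_w(s, χ_k)` for every `s` (★ `IsArchSiegelSection`, K2Liu-p11 (g0)'s
tube frame) and ONE polynomial `P` with `f s u = P(u_{pq}, ū_{pq})` on `K_w` for all `s` (flatness; `P` from ★ glue `exists_mvPolynomial_of_rightKFinite`).
OUTPUT (`exists_whittaker_eq_sum_iteratedDeriv_hLine`).  Data `(κ_j, Θ_j, e_j, m_j, n_j)_j` and `s₀ ∈ ℝ` depending on `P, k, h` only, `Θ_j` HERMITIAN, with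
  `∫ f_s(J · transl x) e(−tr(h x)) dx = Σ_j κ_j · iteratedDeriv e_j (t ↦ xiTwo 1 (h + tΘ_j) (s + 1 − k∕2 + m_j) (s + 1 + k∕2 + n_j)) 0`   for `re s > s₀`
(`x = hermTwo c`, real `t`).  CHAIN: §1 the uniform-in-`s` forms of ★ (III) and ★ (IV-b) (same proofs, the witnesses depend on `P` only); §2 (V-4a) writes each
weight `P_d` as `Σ κ·ℓ_Θ^e` (hermitian `Θ`), ★ (V-1) `iteratedDeriv_xiTwo_hLine` turns `∫ (−2πi tr(Θx))^e ξ-integrand` into the `e`-th real `h`-line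
derivative, and `integral_finsetSum` (integrability ★ `integrable_moment`).
WHAT IS LEFT for LEAD's `g`-line letter `(d∕dt)^d xiShift (1 + t•Ξ) h α β|₀`: the transfer `h`-line → `g`-line ((V-2)∕(V-3), η-picture), a separate file.

HONEST LABEL: HC_CM is proved only modulo the 7 printed citations (2 remaining named inputs: hLiu418 = stmt-HodgeConjecture-24832, h413 =
stmt-HodgeConjecture-24833) until rung 0 closes; organ capital, moves no counter.

## References
[Shimura1997] G. Shimura, *Euler Products and Eisenstein Series*, CBMS 93 (1997), §16 · G. Shimura, Math. Ann. 260 (1982), §3.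
-/

set_option autoImplicit false
set_option linter.dupNamespace false

noncomputable section

open scoped Matrix ComplexConjugate ComplexOrder
open Complex Matrix MeasureTheory
open Literature.NumberTheory.ModularForms.SiegelUpperHalfSpace (moeb)
open Summit.HodgeConjecture.HodgeConjecture.Cruxes.HLiu418.K2LiuHermitianTubeCocycle
open Summit.HodgeConjecture.HodgeConjecture.Cruxes.HLiu418.K2LiuWeylTranslateIwasawa
open Summit.HodgeConjecture.HodgeConjecture.Cruxes.HLiu418.K2LiuKFiniteSectionAtWeylTranslate
open Summit.HodgeConjecture.HodgeConjecture.Cruxes.HLiu418.K2LiuInverseLettersCofactorExpansion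
open Summit.HodgeConjecture.HodgeConjecture.Cruxes.HLiu418.K2LiuKFiniteSectionXiIntegrandMoments
open Summit.HodgeConjecture.HodgeConjecture.Cruxes.HLiu418.K2LiuCompactGroupFiniteFunctions (eval_bind₁)
open Summit.HodgeConjecture.HodgeConjecture.Cruxes.HLiu418.K2LiuHermTwoGammaDefs
open Summit.HodgeConjecture.HodgeConjecture.Cruxes.HLiu418.K2LiuHermTwoConfluentXiDefs
open Summit.HodgeConjecture.HodgeConjecture.Cruxes.HLiu418.K2LiuXiTwoMomentsAsHDerivatives
open Summit.HodgeConjecture.HodgeConjecture.Cruxes.HLiu418.K2LiuPolynomialsAsHermitianTracePowers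

namespace Summit.HodgeConjecture.HodgeConjecture.Cruxes.HLiu418.K2LiuKFiniteSectionWhittakerAsHLineDerivatives

/-! ## §1 Uniform-in-`s` forms of ★ (III) and ★ (IV-b): the witnesses depend on the polynomial `P` only -/

/-- **(III) uniform**: given `P`, ONE `Q` serves every Siegel section `f` of every `I_w(s, χ)` whose restriction to `K_w` is `P`. [cite: Shimura1997, §16.4] -/
theorem exists_uniform_letterPolynomial (P : MvPolynomial (((Fin 2 ⊕ Fin 2) × (Fin 2 ⊕ Fin 2)) ⊕ ((Fin 2 ⊕ Fin 2) × (Fin 2 ⊕ Fin 2))) ℂ) :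
    ∃ Q : MvPolynomial ((Fin 2 × Fin 2) ⊕ (Fin 2 × Fin 2)) ℂ, ∀ (χ : ℂ → ℂ) (s : ℂ) (f : Matrix (Fin 2 ⊕ Fin 2) (Fin 2 ⊕ Fin 2) ℂ → ℂ),
      K2LiuArchInducedTubeDefs.IsArchSiegelSection χ s f →
      (∀ u : Matrix (Fin 2 ⊕ Fin 2) (Fin 2 ⊕ Fin 2) ℂ, uᴴ * Matrix.J (Fin 2) ℂ * u = Matrix.J (Fin 2) ℂ → moeb u (I • (1 : Matrix (Fin 2) (Fin 2) ℂ)) = I • 1 →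
        f u = MvPolynomial.eval (Sum.elim (fun pq => u pq.1 pq.2) (fun pq => conj (u pq.1 pq.2))) P) →
      ∀ b : Matrix (Fin 2) (Fin 2) ℂ, bᴴ = b →
        f (Matrix.J (Fin 2) ℂ * fromBlocks 1 b 0 1) =
          χ (1 - I • b)⁻¹.det * (((‖(1 - I • b)⁻¹.det‖ : ℝ) : ℂ) ^ (2 * s + (Fintype.card (Fin 2) : ℂ))) *
            MvPolynomial.eval (Sum.elim (fun ij : Fin 2 × Fin 2 => (1 + I • b)⁻¹ ij.1 ij.2) (fun ij : Fin 2 × Fin 2 => (1 - I • b)⁻¹ ij.1 ij.2)) Q := by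
  classical
  -- the affine substitution of ★ (III), verbatim
  let δ : Fin 2 → Fin 2 → MvPolynomial ((Fin 2 × Fin 2) ⊕ (Fin 2 × Fin 2)) ℂ := fun i j => MvPolynomial.C ((1 : Matrix (Fin 2) (Fin 2) ℂ) i j)
  let g : (((Fin 2 ⊕ Fin 2) × (Fin 2 ⊕ Fin 2)) ⊕ ((Fin 2 ⊕ Fin 2) × (Fin 2 ⊕ Fin 2))) → MvPolynomial ((Fin 2 × Fin 2) ⊕ (Fin 2 × Fin 2)) ℂ :=
    Sum.elim
      (fun pq => Sum.elim
        (fun i => Sum.elim (fun j => MvPolynomial.C (-I) * (δ i j - MvPolynomial.X (Sum.inl (i, j))))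
          (fun j => -MvPolynomial.X (Sum.inl (i, j))) pq.2)
        (fun i => Sum.elim (fun j => MvPolynomial.X (Sum.inl (i, j)))
          (fun j => MvPolynomial.C (-I) * (δ i j - MvPolynomial.X (Sum.inl (i, j)))) pq.2) pq.1)
      (fun pq => Sum.elim
        (fun i => Sum.elim (fun j => MvPolynomial.C I * (δ j i - MvPolynomial.X (Sum.inr (j, i))))
          (fun j => -MvPolynomial.X (Sum.inr (j, i))) pq.2)
        (fun i => Sum.elim (fun j => MvPolynomial.X (Sum.inr (j, i)))
          (fun j => MvPolynomial.C I * (δ j i - MvPolynomial.X (Sum.inr (j, i)))) pq.2) pq.1)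
  refine ⟨MvPolynomial.bind₁ g P, fun χ s f hf hP b hb => ?_⟩
  rw [section_J_mul_transl hf hb, hP _ (stabFactor_mem hb) (moeb_stabFactor_I hb), eval_bind₁]
  congr 2
  refine congrArg MvPolynomial.eval (funext fun v => ?_)
  have hconj : ∀ p q : Fin 2 ⊕ Fin 2,
      conj ((fromBlocks (b * ((1 - I • b) * (1 + b * b)⁻¹)) (-((1 - I • b) * (1 + b * b)⁻¹)) ((1 - I • b) * (1 + b * b)⁻¹)
        ((1 - I • b) * (1 + b * b)⁻¹ * b) : Matrix (Fin 2 ⊕ Fin 2) (Fin 2 ⊕ Fin 2) ℂ) p q) =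
        (fromBlocks (I • (1 - (1 - I • b)⁻¹)) (1 - I • b)⁻¹ (-(1 - I • b)⁻¹) (I • (1 - (1 - I • b)⁻¹)) : Matrix (Fin 2 ⊕ Fin 2) (Fin 2 ⊕ Fin 2) ℂ) q p := by
    intro p q
    rw [← conjTranspose_stabFactor_eq_affine hb, conjTranspose_apply, star_def]
  rcases v with ⟨p, q⟩ | ⟨p, q⟩
  · simp only [Sum.elim_inl]
    rw [stabFactor_eq_affine hb]
    rcases p with i | i <;> rcases q with j | j <;>
      simp only [g, δ, Sum.elim_inl, Sum.elim_inr, fromBlocks_apply₁₁, fromBlocks_apply₁₂, fromBlocks_apply₂₁, fromBlocks_apply₂₂,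
        Matrix.smul_apply, Matrix.sub_apply, Matrix.neg_apply, smul_eq_mul, map_mul, map_sub, map_neg, MvPolynomial.eval_C, MvPolynomial.eval_X]
  · simp only [Sum.elim_inr]
    rw [hconj]
    rcases p with i | i <;> rcases q with j | j <;>
      simp only [g, δ, Sum.elim_inl, Sum.elim_inr, fromBlocks_apply₁₁, fromBlocks_apply₁₂, fromBlocks_apply₂₁, fromBlocks_apply₂₂,
        Matrix.smul_apply, Matrix.sub_apply, Matrix.neg_apply, smul_eq_mul, map_mul, map_sub, map_neg, MvPolynomial.eval_C, MvPolynomial.eval_X]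

/-- **(IV-b) uniform**: given `P` and the weight `k`, ONE finite family `(P_d, m_d, n_d)` gives the moment expansion for every flat family member and
every `h`. [cite: Shimura1997, §16.4] -/
theorem exists_uniform_moments (P : MvPolynomial (((Fin 2 ⊕ Fin 2) × (Fin 2 ⊕ Fin 2)) ⊕ ((Fin 2 ⊕ Fin 2) × (Fin 2 ⊕ Fin 2))) ℂ) (k : ℤ) :
    ∃ (ι : Finset (((Fin 2 × Fin 2) ⊕ (Fin 2 × Fin 2)) →₀ ℕ)) (Pd : (((Fin 2 × Fin 2) ⊕ (Fin 2 × Fin 2)) →₀ ℕ) → MvPolynomial (Fin 2 × Fin 2) ℂ)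
      (m n : (((Fin 2 × Fin 2) ⊕ (Fin 2 × Fin 2)) →₀ ℕ) → ℕ),
      ∀ (s : ℂ) (f : Matrix (Fin 2 ⊕ Fin 2) (Fin 2 ⊕ Fin 2) ℂ → ℂ),
        K2LiuArchInducedTubeDefs.IsArchSiegelSection (fun z : ℂ => (conj z / ((‖z‖ : ℝ) : ℂ)) ^ k) s f →
        (∀ u : Matrix (Fin 2 ⊕ Fin 2) (Fin 2 ⊕ Fin 2) ℂ, uᴴ * Matrix.J (Fin 2) ℂ * u = Matrix.J (Fin 2) ℂ → moeb u (I • (1 : Matrix (Fin 2) (Fin 2) ℂ)) = I • 1 →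
          f u = MvPolynomial.eval (Sum.elim (fun pq => u pq.1 pq.2) (fun pq => conj (u pq.1 pq.2))) P) →
        ∀ (h : Matrix (Fin 2) (Fin 2) ℂ) (c : ℝ × ℂ × ℝ),
          f (Matrix.J (Fin 2) ℂ * fromBlocks 1 (hermTwo c) 0 1) * cexp (-(2 * Real.pi * I) * (h * hermTwo c).trace) =
            ∑ d ∈ ι, MvPolynomial.eval (fun jk : Fin 2 × Fin 2 => hermTwo c jk.1 jk.2) (Pd d) *
              xiTwoIntegrand 1 h (s + 1 - k / 2 + m d) (s + 1 + k / 2 + n d) c := by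
  obtain ⟨Q, hQ⟩ := exists_uniform_letterPolynomial P
  obtain ⟨Pd, m, n, hPd⟩ := exists_cofactor_expansion Q
  refine ⟨Q.support, fun d => MvPolynomial.C (cexp (-((Real.pi * I) * ((1 + k / 2 + n d) - (1 - k / 2 + m d))))) * Pd d, m, n,
    fun s f hf hP h c => ?_⟩
  have hx : (hermTwo c)ᴴ = hermTwo c := (isHermitian_hermTwo c).eq
  have hcard : (Fintype.card (Fin 2) : ℂ) = 2 := by simp
  have h2 : s + 2 / 2 - (k : ℂ) / 2 = s + 1 - k / 2 := by ring
  have h2' : s + 2 / 2 + (k : ℂ) / 2 = s + 1 + k / 2 := by ring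
  rw [hQ _ s f hf hP _ hx]
  beta_reduce
  rw [modulus_eq hx (arg_det_one_sub_I_smul_hermTwo_ne_pi c) k s, hcard, h2, h2',
    mul_comm ((1 - I • hermTwo c).det ^ (-(s + 1 - (k : ℂ) / 2)) * (1 + I • hermTwo c).det ^ (-(s + 1 + (k : ℂ) / 2))) (MvPolynomial.eval _ Q),
    hPd _ hx, Finset.sum_mul]
  refine Finset.sum_congr rfl fun d _ => ?_
  rw [xiTwoIntegrand_eq, map_mul, MvPolynomial.eval_C]
  have hdiff : (s + 1 + (k : ℂ) / 2 + (n d : ℕ)) - (s + 1 - (k : ℂ) / 2 + (m d : ℕ)) = (1 + k / 2 + n d) - (1 - k / 2 + m d) := by ring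
  rw [hdiff]
  have hE : cexp (-((Real.pi * I) * ((1 + k / 2 + n d) - (1 - k / 2 + m d)))) * cexp ((Real.pi * I) * ((1 + k / 2 + n d) - (1 - k / 2 + m d))) = 1 := by
    rw [← Complex.exp_add, neg_add_cancel, Complex.exp_zero]
  calc MvPolynomial.eval (fun jk : Fin 2 × Fin 2 => hermTwo c jk.1 jk.2) (Pd d) *
        ((1 - I • hermTwo c).det ^ (-(s + 1 - (k : ℂ) / 2 + (m d : ℕ))) * (1 + I • hermTwo c).det ^ (-(s + 1 + (k : ℂ) / 2 + (n d : ℕ)))) *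
          cexp (-(2 * Real.pi * I) * (h * hermTwo c).trace)
        = MvPolynomial.eval (fun jk : Fin 2 × Fin 2 => hermTwo c jk.1 jk.2) (Pd d) *
          (cexp (-((Real.pi * I) * ((1 + k / 2 + n d) - (1 - k / 2 + m d)))) * cexp ((Real.pi * I) * ((1 + k / 2 + n d) - (1 - k / 2 + m d)))) *
            (cexp (-(2 * Real.pi * I) * (h * hermTwo c).trace) *
              ((1 - I • hermTwo c).det ^ (-(s + 1 - (k : ℂ) / 2 + (m d : ℕ))) * (1 + I • hermTwo c).det ^ (-(s + 1 + (k : ℂ) / 2 + (n d : ℕ))))) := by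
          rw [hE]; ring
    _ = _ := by ring

/-! ## §2 The assembly -/

/-- the trace form `ℓ_Θ = Σ_{jk} Θ_{kj} X_{jk}` evaluates to `tr(Θ x)`. [folklore] -/
theorem eval_tracePoly (Θ : Matrix (Fin 2) (Fin 2) ℂ) (c : ℝ × ℂ × ℝ) :
    MvPolynomial.eval (fun jk : Fin 2 × Fin 2 => hermTwo c jk.1 jk.2) (∑ jk : Fin 2 × Fin 2, MvPolynomial.C (Θ jk.2 jk.1) * MvPolynomial.X jk) =
      (Θ * hermTwo c).trace := by
  simp only [Fintype.sum_prod_type, Fin.sum_univ_two, map_mul, map_add, MvPolynomial.eval_C, MvPolynomial.eval_X, Matrix.trace_fin_two,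
    Matrix.mul_apply]
  ring

/-- the trace form has total degree `≤ 1`, so its `e`-th power has total degree `≤ e`. [folklore] -/
theorem totalDegree_tracePoly_pow_le (Θ : Matrix (Fin 2) (Fin 2) ℂ) (e : ℕ) :
    ((∑ jk : Fin 2 × Fin 2, MvPolynomial.C (Θ jk.2 jk.1) * MvPolynomial.X jk : MvPolynomial (Fin 2 × Fin 2) ℂ) ^ e).totalDegree ≤ e := by
  refine (MvPolynomial.totalDegree_pow _ _).trans ?_
  have h1 : (∑ jk : Fin 2 × Fin 2, MvPolynomial.C (Θ jk.2 jk.1) * MvPolynomial.X jk : MvPolynomial (Fin 2 × Fin 2) ℂ).totalDegree ≤ 1 := by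
    refine (MvPolynomial.totalDegree_finsetSum _ _).trans (Finset.sup_le fun jk _ => ?_)
    refine (MvPolynomial.totalDegree_mul _ _).trans ?_
    rw [MvPolynomial.totalDegree_C, zero_add]
    exact (MvPolynomial.totalDegree_X (R := ℂ) jk).le
  calc e * _ ≤ e * 1 := Nat.mul_le_mul_left e h1
    _ = e := mul_one e

/-- **a single trace-power moment is a real `h`-line derivative**: for hermitian `h, Θ` and `re(A+B) > 3 + e`,
`∫ tr(Θx)^e · ξ-integrand(1, h; A, B) = (−2πi)^{−e} · (d∕dt)^e|₀ ξ(1, h + tΘ; A, B)`. [cite: Shimura1997, §16.4] -/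
theorem integral_tracePow_mul_xiTwoIntegrand {h Θ : Matrix (Fin 2) (Fin 2) ℂ} (hh : h.IsHermitian) (hΘ : Θ.IsHermitian) {A B : ℂ} (e : ℕ)
    (hAB : 3 + (e : ℝ) < (A + B).re) :
    ∫ c : ℝ × ℂ × ℝ, (Θ * hermTwo c).trace ^ e * xiTwoIntegrand 1 h A B c =
      ((-(2 * Real.pi * I))⁻¹) ^ e * iteratedDeriv e (fun t : ℝ => xiTwo 1 (h + (t : ℂ) • Θ) A B) 0 := by
  have h2pi : (-(2 * Real.pi * I) : ℂ) ≠ 0 := by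
    simp [Real.pi_ne_zero, I_ne_zero]
  rw [iteratedDeriv_xiTwo_hLine hh hΘ e hAB 0, Complex.ofReal_zero, zero_smul, add_zero, ← integral_const_mul]
  refine integral_congr_ae (Filter.Eventually.of_forall fun c => ?_)
  simp only [mul_pow, ← mul_assoc, inv_pow, inv_mul_cancel₀ (pow_ne_zero e h2pi), one_mul]

/-- **THE WHITTAKER COEFFICIENT OF A `K_w`-FINITE FLAT WEIGHT-`k` SECTION ON `U(2,2)` AS A FINITE COMBINATION OF REAL `h`-LINE DERIVATIVES OF `ξ`.**
Given the polynomial `P` (the common restriction to `K_w`), the weight `k` and a hermitian `h`, there are finitely many `(κ_j, Θ_j, e_j, m_j, n_j)` with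
`Θ_j` hermitian and `s₀ ∈ ℝ` such that for every `s` with `re s > s₀` and every Siegel section `f` of `I_w(s, χ_k)` with `f|_{K_w} = P`:
`∫ f(J · transl x) e(−tr(hx)) dx = Σ_j κ_j · iteratedDeriv e_j (t ↦ ξ(1, h + tΘ_j; s + 1 − k∕2 + m_j, s + 1 + k∕2 + n_j)) 0`. [cite: Shimura1997, §16.4] -/
theorem exists_whittaker_eq_sum_iteratedDeriv_hLine
    (P : MvPolynomial (((Fin 2 ⊕ Fin 2) × (Fin 2 ⊕ Fin 2)) ⊕ ((Fin 2 ⊕ Fin 2) × (Fin 2 ⊕ Fin 2))) ℂ) (k : ℤ)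
    {h : Matrix (Fin 2) (Fin 2) ℂ} (hh : h.IsHermitian) :
    ∃ (J : Finset (Σ _ : ((Fin 2 × Fin 2) ⊕ (Fin 2 × Fin 2)) →₀ ℕ, {M : Matrix (Fin 2) (Fin 2) ℂ // M.IsHermitian} × ℕ))
      (κ : (Σ _ : ((Fin 2 × Fin 2) ⊕ (Fin 2 × Fin 2)) →₀ ℕ, {M : Matrix (Fin 2) (Fin 2) ℂ // M.IsHermitian} × ℕ) → ℂ)
      (m n : (Σ _ : ((Fin 2 × Fin 2) ⊕ (Fin 2 × Fin 2)) →₀ ℕ, {M : Matrix (Fin 2) (Fin 2) ℂ // M.IsHermitian} × ℕ) → ℕ) (s₀ : ℝ),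
      ∀ (s : ℂ), s₀ < s.re → ∀ (f : Matrix (Fin 2 ⊕ Fin 2) (Fin 2 ⊕ Fin 2) ℂ → ℂ),
        K2LiuArchInducedTubeDefs.IsArchSiegelSection (fun z : ℂ => (conj z / ((‖z‖ : ℝ) : ℂ)) ^ k) s f →
        (∀ u : Matrix (Fin 2 ⊕ Fin 2) (Fin 2 ⊕ Fin 2) ℂ, uᴴ * Matrix.J (Fin 2) ℂ * u = Matrix.J (Fin 2) ℂ → moeb u (I • (1 : Matrix (Fin 2) (Fin 2) ℂ)) = I • 1 →
          f u = MvPolynomial.eval (Sum.elim (fun pq => u pq.1 pq.2) (fun pq => conj (u pq.1 pq.2))) P) →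
        ∫ c : ℝ × ℂ × ℝ, f (Matrix.J (Fin 2) ℂ * fromBlocks 1 (hermTwo c) 0 1) * cexp (-(2 * Real.pi * I) * (h * hermTwo c).trace) =
          ∑ j ∈ J, κ j * iteratedDeriv j.2.2
            (fun t : ℝ => xiTwo 1 (h + (t : ℂ) • (j.2.1 : Matrix (Fin 2) (Fin 2) ℂ)) (s + 1 - k / 2 + m j) (s + 1 + k / 2 + n j)) 0 := by
  classical
  obtain ⟨ι, Pd, m, n, hmom⟩ := exists_uniform_moments P k
  -- (V-4a): each weight as a combination of hermitian trace powers
  choose κ hκ using fun d => exists_finsupp_eq_sum_tracePow (Pd d)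
  refine ⟨ι.sigma fun d => (κ d).support, fun j => κ j.1 j.2 * ((-(2 * Real.pi * I))⁻¹) ^ j.2.2, fun j => m j.1, fun j => n j.1,
    1 + ∑ j ∈ ι.sigma fun d => (κ d).support, (j.2.2 : ℝ), fun s hs f hf hP => ?_⟩
  -- exponent bookkeeping: `re(A_d + B_d) = 2 re s + 2 + m_d + n_d`
  have hre : ∀ d, ((s + 1 - (k : ℂ) / 2 + (m d : ℕ)) + (s + 1 + (k : ℂ) / 2 + (n d : ℕ))).re = 2 * s.re + 2 + m d + n d := by
    intro d
    rw [show (s + 1 - (k : ℂ) / 2 + (m d : ℕ)) + (s + 1 + (k : ℂ) / 2 + (n d : ℕ)) = s + s + ((2 + m d + n d : ℕ) : ℂ) by push_cast; ring,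
      Complex.add_re, Complex.add_re, Complex.natCast_re]
    push_cast
    ring
  have hAB : ∀ j ∈ ι.sigma (fun d => (κ d).support),
      3 + (j.2.2 : ℝ) < ((s + 1 - (k : ℂ) / 2 + (m j.1 : ℕ)) + (s + 1 + (k : ℂ) / 2 + (n j.1 : ℕ))).re := by
    intro j hj
    have hej : (j.2.2 : ℝ) ≤ ∑ j ∈ ι.sigma (fun d => (κ d).support), (j.2.2 : ℝ) :=
      Finset.single_le_sum (f := fun j : (Σ _ : ((Fin 2 × Fin 2) ⊕ (Fin 2 × Fin 2)) →₀ ℕ, {M : Matrix (Fin 2) (Fin 2) ℂ // M.IsHermitian} × ℕ) =>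
        (j.2.2 : ℝ)) (fun _ _ => Nat.cast_nonneg _) hj
    rw [hre]
    have hm : (0 : ℝ) ≤ m j.1 := Nat.cast_nonneg _
    have hn : (0 : ℝ) ≤ n j.1 := Nat.cast_nonneg _
    linarith
  -- Step 1: the integrand, expanded pointwise
  have hpt : ∀ c : ℝ × ℂ × ℝ,
      f (Matrix.J (Fin 2) ℂ * fromBlocks 1 (hermTwo c) 0 1) * cexp (-(2 * Real.pi * I) * (h * hermTwo c).trace) =
        ∑ j ∈ ι.sigma (fun d => (κ d).support), κ j.1 j.2 *
          (((j.2.1 : Matrix (Fin 2) (Fin 2) ℂ) * hermTwo c).trace ^ j.2.2 * xiTwoIntegrand 1 h (s + 1 - k / 2 + m j.1) (s + 1 + k / 2 + n j.1) c) := by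
    intro c
    rw [hmom s f hf hP h c, Finset.sum_sigma]
    refine Finset.sum_congr rfl fun d _ => ?_
    conv_lhs => rw [← hκ d]
    rw [Finsupp.sum, map_sum, Finset.sum_mul]
    refine Finset.sum_congr rfl fun p _ => ?_
    rw [MvPolynomial.smul_eq_C_mul, map_mul, MvPolynomial.eval_C, map_pow, eval_tracePoly, mul_assoc]
  -- Step 2: each term is integrable
  have hint : ∀ j ∈ ι.sigma (fun d => (κ d).support), Integrable (fun c : ℝ × ℂ × ℝ => κ j.1 j.2 *
      (((j.2.1 : Matrix (Fin 2) (Fin 2) ℂ) * hermTwo c).trace ^ j.2.2 * xiTwoIntegrand 1 h (s + 1 - k / 2 + m j.1) (s + 1 + k / 2 + n j.1) c)) := by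
    intro j hj
    have hdeg := totalDegree_tracePoly_pow_le (j.2.1 : Matrix (Fin 2) (Fin 2) ℂ) j.2.2
    have h0 := integrable_moment ((∑ jk : Fin 2 × Fin 2, MvPolynomial.C ((j.2.1 : Matrix (Fin 2) (Fin 2) ℂ) jk.2 jk.1) * MvPolynomial.X jk) ^ j.2.2) hh
      (A := s + 1 - k / 2 + m j.1) (B := s + 1 + k / 2 + n j.1)
      (by have h1 := hAB j hj; have h2 : ((((∑ jk : Fin 2 × Fin 2, MvPolynomial.C ((j.2.1 : Matrix (Fin 2) (Fin 2) ℂ) jk.2 jk.1) * MvPolynomial.X jk) ^ j.2.2 :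
            MvPolynomial (Fin 2 × Fin 2) ℂ).totalDegree : ℕ) : ℝ) ≤ j.2.2 := by exact_mod_cast hdeg
          linarith)
    refine (h0.const_mul (κ j.1 j.2)).congr (Filter.Eventually.of_forall fun c => ?_)
    simp only [map_pow, eval_tracePoly]
  -- Step 3: integrate termwise and recognise the derivatives
  rw [integral_congr_ae (Filter.Eventually.of_forall hpt), integral_finsetSum _ hint]
  refine Finset.sum_congr rfl fun j hj => ?_
  rw [integral_const_mul, integral_tracePow_mul_xiTwoIntegrand hh j.2.1.2 j.2.2 (hAB j hj)]
  beta_reduce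
  ring

end Summit.HodgeConjecture.HodgeConjecture.Cruxes.HLiu418.K2LiuKFiniteSectionWhittakerAsHLineDerivatives

end
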